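import Summits.QuantumFields.YangMills.Theorems.BalabanUVNodesN06Eq3132CoerciveVariationalQ

/-!
# BalabanUVNodes ∕ N06 ([B9], `Dag.B9_main`) — R1 J-TWIN 2∕≈18 (PILOT of rule (R)′): THE ROW-26 COERCIVITY BINDER `hcoA` FOR `𝔮 (Δ⁻¹) 𝔮⋆` ALONG A
# SUB-FAMILY `f : J → MemberY …` — the J-twin of ✓`…N06Eq3132CoerciveVariationalQ.hcoA_of_testFamily_QR` (dag-n06-l g37)

Track A of `YM-PLAN.md` (cell `pub-ymgap`, HUMAN RULING D-0062), node **N06** = [Balaban1985BackgroundPropagators]; IR-N06-SECTION-2 road **R1** («J-twin of the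
producer cone», ★★★ director-ym №524 (3): authorised in principle, STAGED, sibling files only, one file on a by-name ask), dag-n06-d's `R1-JTWIN-SPEC.md` rule (R)′
(2026-08-31): re-key EXACTLY the section-tainted ∀-member rows along `f`, keep data ∕ pins ∕ laws ∕ section-free rows member-wide, conclusions along `f`; BY-NAME ASK №1
(dag-n06-d g29 → dag-n06-l g41, 2026-08-31).  Seat `pub-ymgap-dag-n06-l` g41.

WHAT.  `hcoA_of_testFamily_QR_J` = the SAME statement and proof as ✓`hcoA_of_testFamily_QR` with an index type `J` and a map `f : J → MemberY d ℓ hd hL b₀ b₁ Mstar` added and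
* the ONE section-tainted row — ROW 17 `hΔ` (the knit certificate's `hΔAK` species: `IsSymmTr 1 (Δ(U)) ∧ PosDefTr 1 (Δ(U))` under Thm 3.11's prefix) — re-keyed
  `∀ x : MemberY … ↦ ∀ j : J` and read at `f j` (TAINTED ROWS OF THIS TWIN: `hΔ` only);
* the letter families `𝔮 𝔮⋆ Δ T₀ T`, the pin `hT₀`, the (3.35)-law `hadj` and the SECTION-FREE test-family row `hT` ((P′2)∕(P′1), produced member-wide by
  ✓`…Eq3132KnitTestFamilyQ.hTt_knit_of_pins` from laws ∕ pins ∕ numerics only) LEFT member-wide, read at `f j` inside;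
* the conclusion `CoerciveUnder c35 geo bg S` taken at the index type `I := J`: `geo := fun j => geoComap (geo9Y (f j)) Prod.fst`, `bg := fun j => bg9YR … R₁ R₂ (f j)`,
  `S := fun j U => normMatY (trBasis N) Λ⁻¹ (QGQOfQY (f j).toKIdx (𝔮 (f j)) (𝔮⋆ (f j)) (T₀ (f j)) U)` — rule (R)′.3 (the shapes of `B9LeafXCodedKnitU.*_reindex f`).
The member-wide parent is the instance `J := MemberY …`, `f := id` (nothing is lost).  CONSUMERS (to come, not in the tree today): `…D2SupPrechainV2AtPinsPUWQ`ᴶ and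
`…Eq3132FromStateKnitQ`ᴶ (R1 ORDER, SPEC); until then this file is an ORPHAN by design (honest).
HONEST FRAMING: a re-indexing of a landed composition; one theorem, 0 `def`, 0 `sorry`, standard axioms; the test family and `hΔ` are HYPOTHESES; nothing of [B9] ∕ [4] asserted;
COUNT-NEUTRAL (`--supports stmt-QuantumFields-27239 --as helper`); N06 NOT discharged; under R1 the inner-corner question stays DISPLAYED at the K1 face ∕ NODE O join by (α5);
nothing continuum ∕ OS ∕ mass gap ∕ Clay.
[cite: Balaban1984PropagatorsII, (2.147) p.249; Balaban1985BackgroundPropagators, (3.132) p.422, Thm 3.11 p.416, Thm 3.12 p.423 (prefix), (3.13) p.393, (3.115) p.418]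
-/

noncomputable section

namespace Summit.QuantumFields.YangMills.BalabanUVNodes.N06Eq3132CoerciveVariationalQJ

open scoped Matrix.Norms.L2Operator
open Literature.MathematicalPhysics.QuantumFieldTheory.Balaban1983to89
open Literature.MathematicalPhysics.QuantumFieldTheory.Balaban1983to89.Node00
open Literature.MathematicalPhysics.QuantumFieldTheory.Balaban1983to89.B6KLevelCensusIndexV1 (KIdx)
open Literature.MathematicalPhysics.QuantumFieldTheory.Balaban1983to89.B9PinMembersKLevelV1 (MemberY geo9Y bg9Y)
open Literature.MathematicalPhysics.QuantumFieldTheory.Balaban1983to89.B9BackgroundsKLevelV1R (RegFamY bg9YR)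
open Literature.MathematicalPhysics.QuantumFieldTheory.Balaban1983to89.B9Thm311ReadingCoords (trIP PosDefTr IsSymmTr IsAdjTr)
open Literature.MathematicalPhysics.QuantumFieldTheory.Balaban1983to89.B9CoReadingCoordsTranspose (TrIdx trBasis trBasis_repr_eq_trace)
open Literature.MathematicalPhysics.QuantumFieldTheory.Balaban1983to89.B9Eq3132RingInverseReading (normMatY dimConstY' dimConstY'_pos)
open Literature.MathematicalPhysics.QuantumFieldTheory.Balaban1983to89.B9Eq3132NuReading (lamInvY)
open Literature.MathematicalPhysics.QuantumFieldTheory.Balaban1983to89.B9Eq3132CTInputs (CoerciveUnder)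
open Literature.MathematicalPhysics.QuantumFieldTheory.Balaban1983to89.B9Eq3132ScalarIndex (geoComap)
open Literature.MathematicalPhysics.QuantumFieldTheory.Balaban1983to89.B9Eq3132CoerciveVariational (coercive_normMatY_of_testOp)

variable {N : ℕ}

section TestFamily

variable {d ℓ : ℕ} {hd : 1 ≤ d + 1} {hL : Odd (ℓ + 1) ∧ 1 < ℓ + 1} {b₀ b₁ : ℝ} (Mstar : ℕ) {G : Subgroup (Matrix (Fin N) (Fin N) ℂ)ˣ}
variable (R₁ R₂ : RegFamY d ℓ hd hL b₀ b₁ Mstar (Matrix (Fin N) (Fin N) ℂ))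

/-- ★★ **R1 J-TWIN of `hcoA_of_testFamily_QR` — THE ROW-26 COERCIVITY BINDER `hcoA` FOR `𝔮 (Δ⁻¹) 𝔮⋆` ALONG `f : J → MemberY …`**: letter families `𝔮 ∕ 𝔮⋆`
trace-adjoint on the carrier's (3.35) (`hadj`, member-wide law); a form family `Δ` trace-symmetric and positive definite under ROW 17's prefix AT THE MEMBERS `f j` ONLY
(`hΔ`, the one section-tainted row, re-keyed along `f`); `T₀ x U = Ring.inverse (Δ x U)` (member-wide pin); a member-wide test family `T` with (P′2)∕(P′1) and uniform
`ϑ < 1`, `C > 0` (section-free row, left member-wide).  THEN `CoerciveUnder c35 (fun j => geoComap (geo9Y (f j)) Prod.fst) (fun j => bg9YR … R₁ R₂ (f j))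
(fun j U => normMatY (trBasis N) Λ⁻¹ (QGQOfQY (f j).toKIdx (𝔮 (f j)) (𝔮⋆ (f j)) (T₀ (f j)) U))` with constant `(1−ϑ)²∕(C·κ′)` — the parent at `J := MemberY …, f := id`.
[cite: Balaban1984PropagatorsII, (2.147) p.249; Balaban1985BackgroundPropagators, (3.132) p.422, Thm 3.11 p.416, Thm 3.12 p.423 (prefix), (3.13) p.393] -/
theorem hcoA_of_testFamily_QR_J
    [∀ x : MemberY d ℓ hd hL b₀ b₁ Mstar, Fintype (geo9Y x).Site]
    [∀ x : MemberY d ℓ hd hL b₀ b₁ Mstar, DecidableEq (geo9Y x).Site] {J : Type} (f : J → MemberY d ℓ hd hL b₀ b₁ Mstar) {c35 : ℝ}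
    (𝔮 : ∀ x : MemberY d ℓ hd hL b₀ b₁ Mstar, CfgY (Matrix (Fin N) (Fin N) ℂ) x.toKIdx →
      ((FBondY x.toKIdx → Matrix (Fin N) (Fin N) ℂ) →ₗ[ℂ] (IBondY x.toKIdx → Matrix (Fin N) (Fin N) ℂ)))
    (𝔮s : ∀ x : MemberY d ℓ hd hL b₀ b₁ Mstar, CfgY (Matrix (Fin N) (Fin N) ℂ) x.toKIdx →
      ((IBondY x.toKIdx → Matrix (Fin N) (Fin N) ℂ) →ₗ[ℂ] (FBondY x.toKIdx → Matrix (Fin N) (Fin N) ℂ)))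
    (Δ : ∀ x : MemberY d ℓ hd hL b₀ b₁ Mstar, CfgY (Matrix (Fin N) (Fin N) ℂ) x.toKIdx →
      ((FBondY x.toKIdx → Matrix (Fin N) (Fin N) ℂ) →ₗ[ℂ] (FBondY x.toKIdx → Matrix (Fin N) (Fin N) ℂ)))
    (T₀ : ∀ x : MemberY d ℓ hd hL b₀ b₁ Mstar, BondOpY (Matrix (Fin N) (Fin N) ℂ) x.toKIdx)
    (hT₀ : ∀ (x : MemberY d ℓ hd hL b₀ b₁ Mstar) (U : CfgY (Matrix (Fin N) (Fin N) ℂ) x.toKIdx), T₀ x U = Ring.inverse (Δ x U))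
    (hadj : ∀ (x : MemberY d ℓ hd hL b₀ b₁ Mstar) (α₀ : ℝ) (U : (bg9YR (Matrix (Fin N) (Fin N) ℂ) G R₁ R₂ x).Cfg),
      (bg9YR (Matrix (Fin N) (Fin N) ℂ) G R₁ R₂ x).Reg335 c35 α₀ U → IsAdjTr (fun _ => (1 : ℝ)) (fun _ => (1 : ℝ)) (𝔮 x U) (𝔮s x U))
    (a311 M311 : ℝ) (ha311 : 0 < a311) (hM311 : 0 < M311)
    (hΔ : ∀ j : J, M311 ≤ (geo9Y (f j)).M → ∀ α₀ : ℝ, 0 < α₀ → (geo9Y (f j)).M * α₀ ≤ a311 →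
      ∀ U : (bg9YR (Matrix (Fin N) (Fin N) ℂ) G R₁ R₂ (f j)).Cfg, (bg9YR (Matrix (Fin N) (Fin N) ℂ) G R₁ R₂ (f j)).Reg335 c35 α₀ U →
        IsSymmTr (fun _ => (1 : ℝ)) (Δ (f j) U) ∧ PosDefTr (fun _ => (1 : ℝ)) (Δ (f j) U))
    (T : ∀ x : MemberY d ℓ hd hL b₀ b₁ Mstar, CfgY (Matrix (Fin N) (Fin N) ℂ) x.toKIdx →
      (IBondY x.toKIdx → Matrix (Fin N) (Fin N) ℂ) → (FBondY x.toKIdx → Matrix (Fin N) (Fin N) ℂ))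
    (hT : ∃ Mt aT ϑ C : ℝ, 0 < Mt ∧ 0 < aT ∧ ϑ < 1 ∧ 0 < C ∧
      ∀ x : MemberY d ℓ hd hL b₀ b₁ Mstar, Mt ≤ (geo9Y x).M → ∀ α₀ : ℝ, 0 < α₀ → (geo9Y x).M * α₀ ≤ aT →
        ∀ U : (bg9YR (Matrix (Fin N) (Fin N) ℂ) G R₁ R₂ x).Cfg,
          (bg9YR (Matrix (Fin N) (Fin N) ℂ) G R₁ R₂ x).Reg335 c35 α₀ U → (bg9YR (Matrix (Fin N) (Fin N) ℂ) G R₁ R₂ x).Reg336 c35 α₀ U →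
            (∀ Ψ : IBondY x.toKIdx → Matrix (Fin N) (Fin N) ℂ,
              (1 - ϑ) * trIP (fun _ => (1 : ℝ)) Ψ Ψ ≤ trIP (fun _ => (1 : ℝ)) (𝔮 x U (T x U Ψ)) (fun y => lamInvY x.toKIdx y • Ψ y)) ∧
            (∀ Ψ : IBondY x.toKIdx → Matrix (Fin N) (Fin N) ℂ,
              trIP (fun _ => (1 : ℝ)) (T x U Ψ) (Δ x U (T x U Ψ)) ≤ C * trIP (fun _ => (1 : ℝ)) Ψ Ψ)) :
    CoerciveUnder c35
      (fun j : J => geoComap (geo9Y (f j)) (Prod.fst : (geo9Y (f j)).Site × TrIdx N → (geo9Y (f j)).Site))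
      (fun j : J => bg9YR (Matrix (Fin N) (Fin N) ℂ) G R₁ R₂ (f j))
      (fun j U => normMatY (trBasis N) (lamInvY (f j).toKIdx) (QGQOfQY (f j).toKIdx (𝔮 (f j)) (𝔮s (f j)) (T₀ (f j)) U)) := by
  have hT₀' : T₀ = fun (x : MemberY d ℓ hd hL b₀ b₁ Mstar) (U : CfgY (Matrix (Fin N) (Fin N) ℂ) x.toKIdx) => Ring.inverse (Δ x U) :=
    funext fun x => funext fun U => hT₀ x U
  subst hT₀'
  obtain ⟨Mt, aT, ϑ, C, hMt, hat, hϑ, hC, hT⟩ := hT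
  refine ⟨max M311 Mt, min a311 aT, (1 - ϑ) ^ 2 / (C * dimConstY' (trBasis N)), lt_of_lt_of_le hM311 (le_max_left _ _), lt_min ha311 hat,
    div_pos (by nlinarith) (mul_pos hC (dimConstY'_pos _)), fun j hM α₀ hα₀ hMa U hU hU' => ?_⟩
  obtain ⟨hsymm, hpos⟩ := hΔ j ((le_max_left _ _).trans hM) α₀ hα₀ (hMa.trans (min_le_left _ _)) U hU
  obtain ⟨hP2, hP1⟩ := hT (f j) ((le_max_right _ _).trans hM) α₀ hα₀ (hMa.trans (min_le_right _ _)) U hU hU'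
  have key := coercive_normMatY_of_testOp (trBasis N) (trBasis_repr_eq_trace N) _ hsymm hpos _ _ (hadj (f j) α₀ U hU) (lamInvY (f j).toKIdx) (T (f j) U)
    hϑ.le hC hP2 hP1
  -- the goal reads the index bonds as `(geo9Y (f j)).Site` with the family's `Fintype ∕ DecidableEq` instances at `f j`, `key` with the global ones (equal by
  -- `Subsingleton.elim`, which `convert` discharges); `QGQOfQY` IS the composite `𝔮 ∘ T₀ ∘ 𝔮⋆` by `rfl`
  beta_reduce
  convert key using 3
  all_goals rfl

end TestFamily

end Summit.QuantumFields.YangMills.BalabanUVNodes.N06Eq3132CoerciveVariationalQJ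

end
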